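import Literature.Geometry.Lorentzian.LocalConstraintDeformationChart
import Literature.Geometry.Lorentzian.InitialDataPatch
import Literature.Analysis.InnerProduct.PositiveDefiniteStability
import HarnessLib

/-!
# Local deformations of the constraints: reassembly of coordinate families into data on `X`

Topic `Literature/Geometry/Lorentzian`. Everything here is PROVED; no definition, no statement of
`Prop` type is introduced.

Second half of the bookkeeping of the assembly of the named fact
`ChruscielDelay_localConstraintDeformation` (`LocalConstraintDeformation.lean`; Chruściel–Delay
2003, Thm. 5.9 / Prop. 5.10 / Cor. 5.11) around its coordinate cores
(`LocalConstraintDeformationChart.lean` reads the data and the witnessed tangents IN the chart;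
this file transports coordinate deformation families BACK). With `c = chartAt E3 x₀`, target `𝓣`,
inverse chart `Φ`, `B̄ = closedBall (c x₀) ρ ⊆ 𝓣`:

* `InitialDataSet.val_metric_comap_symm_of_eq_pullbackBilin`, `k_comap_symm_of_eq_pullbackBilin`,
  `isVacuumAt_symm_of_coordVacuum` — if the sections of `D₁` on `c.source` are `c^* S`, `c^* T`,
  then the readings of `Φ^* D₁` are `(S, T)`, and coordinate vacuum of `(S, T)` at `u ∈ 𝓣` is
  vacuum of `D₁` at `Φ u`;
* `InitialDataSet.exists_localFamily_of_coordFamily` — **reassembly**: a family of coordinate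
  fields `(G_c, K_c)`, `c ∈ ball 0 r ⊆ ℝᵏ`, jointly smooth on `ball × 𝓣`, through the readings
  `(G, K)` of `Φ^* D` at `c = 0`, equal to `(G, K)` off `B̄`, symmetric and solving the coordinate
  vacuum constraints on `𝓣`, is transported back to `X` (pull back along `c`,
  `ChartBilinPullback.lean`; positivity for small `c`, `PositiveDefiniteStability.lean`; patch into
  `D` off `Φ(B̄)`, `InitialDataPatch.lean`) as a family `G₀` of VACUUM initial data sets on `X`,
  jointly smooth on `ball 0 r₁ × X`, through `D`, equal to `D` off the compact set `Φ(B̄)`, whose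
  sections on `c.source` are `c^* G_c`, `c^* K_c` (Chruściel–Delay 2003, Cor. 5.11: "the new
  solution … can be smoothly continued to `M ∖ Ω` by `(K₀, g₀)`");
* `InitialDataSet.deriv_section_eq_pullbackBilin`, `deriv_section_eq_zero` — the tangents of such
  a family: `d/ds|₀ σ_{s e_j} = c^*(∂_{c_j}|₀ S)` on `c.source`, `0` where the family is constant.

## References

* P. T. Chruściel, E. Delay, Mém. Soc. Math. Fr. 94 (2003), Thm. 5.9, Prop. 5.10, Cor. 5.11.
  [ChruscielDelay2003]
* R. Bartnik, J. Isenberg, *The constraint equations* (2004), §2. [BartnikIsenberg2004]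
* J. Corvino, Comm. Math. Phys. 214 (2000), §4. [Corvino2000]
-/

noncomputable section

set_option maxSynthPendingDepth 3

open Bundle Set Function Filter TopologicalSpace Manifold Module Metric
open scoped Manifold ContDiff Topology

namespace Literature.Geometry.Lorentzian

namespace InitialDataSet

variable {X : Type*} [TopologicalSpace X] [ChartedSpace E3 X] [IsManifold (𝓡 3) ∞ X]

/-! ### Readings and vacuum of data whose sections on the chart source are pullbacks -/

/-- **Readings of `Φ^* D₁` when the sections of `D₁` on the chart source are pullbacks along
the chart**: if `h₁ = c^* S` on `c.source` then the metric of `Φ^* D₁` at `y ∈ c.target` is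
`S y` (`Φ^*(c^* S) = S`, `ChartInverse.pullbackBilin_symm_pullbackBilin_chart`). [folklore] -/
theorem val_metric_comap_symm_of_eq_pullbackBilin (x₀ : X) (D₁ : InitialDataSet (𝓡 3) X)
    (S : E3 → E3 →L[ℝ] E3 →L[ℝ] ℝ)
    (hS : ∀ p ∈ (chartAt E3 x₀).source,
      D₁.h.inner p = pullbackBilin (I := 𝓘(ℝ, E3)) (I' := 𝓡 3) (chartAt E3 x₀) S p)
    (y : (⟨(chartAt E3 x₀).target, (chartAt E3 x₀).open_target⟩ : Opens E3)) :
    (D₁.comap _ (ChartInverse.contMDiff_symm x₀) (ChartInverse.injective_mfderiv_symm x₀)).metric.val y =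
      S y := by
  have hy : (chartAt E3 x₀).symm y ∈ (chartAt E3 x₀).source := (chartAt E3 x₀).map_target y.2
  rw [val_metric]
  ext v w
  rw [comap_h_inner, hS _ hy]
  simp only [pullbackBilin_apply, ChartInverse.mfderiv_chart_mfderiv_symm_apply]
  rw [(chartAt E3 x₀).right_inv y.2]
  rfl

/-- Same for the tensor `k`: if `k₁ = c^* S` on `c.source` then `(Φ^* D₁).k y = S y`.
[folklore] -/
theorem k_comap_symm_of_eq_pullbackBilin (x₀ : X) (D₁ : InitialDataSet (𝓡 3) X)
    (S : E3 → E3 →L[ℝ] E3 →L[ℝ] ℝ)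
    (hS : ∀ p ∈ (chartAt E3 x₀).source,
      D₁.k p = pullbackBilin (I := 𝓘(ℝ, E3)) (I' := 𝓡 3) (chartAt E3 x₀) S p)
    (y : (⟨(chartAt E3 x₀).target, (chartAt E3 x₀).open_target⟩ : Opens E3)) :
    (D₁.comap _ (ChartInverse.contMDiff_symm x₀) (ChartInverse.injective_mfderiv_symm x₀)).k y =
      S y := by
  have hy : (chartAt E3 x₀).symm y ∈ (chartAt E3 x₀).source := (chartAt E3 x₀).map_target y.2
  ext v w
  rw [comap_k, hS _ hy]
  simp only [pullbackBilin_apply, ChartInverse.mfderiv_chart_mfderiv_symm_apply]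
  rw [(chartAt E3 x₀).right_inv y.2]
  rfl

/-- **Vacuum at the points of the chart source from coordinate vacuum of the readings**: if the
sections of `D₁` on `c.source` are `c^* S`, `c^* T` and `(S, T)` solve the coordinate vacuum
constraints at `u ∈ c.target`, then `D₁` satisfies the vacuum constraints at `c.symm u`
(naturality `isVacuumAt_comap_iff` along the inverse chart and the bridge
`OpensChart.hamiltonianConstraintFn_eq_hamAt` / `momentumConstraintFn_eq_momFn`).
[cite: BartnikIsenberg2004, (2.1)–(2.2)] -/
theorem isVacuumAt_symm_of_coordVacuum (x₀ : X) (D₁ : InitialDataSet (𝓡 3) X)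
    [D₁.metric.HasLeviCivita] (S T : E3 → E3 →L[ℝ] E3 →L[ℝ] ℝ)
    (hS : ∀ p ∈ (chartAt E3 x₀).source,
      D₁.h.inner p = pullbackBilin (I := 𝓘(ℝ, E3)) (I' := 𝓡 3) (chartAt E3 x₀) S p)
    (hT : ∀ p ∈ (chartAt E3 x₀).source,
      D₁.k p = pullbackBilin (I := 𝓘(ℝ, E3)) (I' := 𝓡 3) (chartAt E3 x₀) T p)
    {ι : Type*} [Fintype ι] (b₀ : Basis ι ℝ E3)
    (u : (⟨(chartAt E3 x₀).target, (chartAt E3 x₀).open_target⟩ : Opens E3))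
    (hcv : MetricCoord.hamAt S T u = 0 ∧ ∀ Z : E3, MetricCoord.momFn b₀ S T u Z = 0) :
    D₁.hamiltonianConstraintFn ((chartAt E3 x₀).symm u) = 0 ∧
      D₁.momentumConstraintFn ((chartAt E3 x₀).symm u) = 0 := by
  haveI := (D₁.comap _ (ChartInverse.contMDiff_symm x₀)
    (ChartInverse.injective_mfderiv_symm x₀)).metric.hasLeviCivita
  have hG := val_metric_comap_symm_of_eq_pullbackBilin x₀ D₁ S hS
  have hK := k_comap_symm_of_eq_pullbackBilin x₀ D₁ T hT
  refine (isVacuumAt_comap_iff D₁ (ChartInverse.contMDiff_symm x₀)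
    (ChartInverse.injective_mfderiv_symm x₀) u).1 ⟨?_, ?_⟩
  · rw [OpensChart.hamiltonianConstraintFn_eq_hamAt hG hK u]
    exact hcv.1
  · refine LinearMap.ext fun v ↦ ?_
    rw [OpensChart.momentumConstraintFn_eq_momFn hG hK b₀ u v, hcv.2 v, LinearMap.zero_apply]

/-! ### Reassembly: from coordinate families on the chart target to data on `X` -/

section Reassembly

variable [T2Space X]
set_option maxHeartbeats 400000 in -- buildfix (bf3-g26): 160k/180k FAIL, 200k PASS at accept time; line-neutral budget line
/-- **Reassembly of a coordinate deformation family into initial data sets on `X`.** Let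
`(G_c, K_c)`, `c ∈ ball 0 r ⊆ ℝᵏ`, be coordinate fields on the chart target `𝓣` of
`c = chartAt E3 x₀`, jointly `C^∞` on `ball × 𝓣`, equal at `c = 0` — and, off the closed ball
`B̄ = closedBall (c x₀) ρ ⊆ 𝓣`, for every `c` — to the readings `(G, K)` of `Φ^* D`, symmetric,
and solving the coordinate vacuum constraints on `𝓣`. Then for some `0 < r₁ ≤ r` there is a
family `G₀` of initial data sets on `X` with: both section maps `C^∞` on `ball 0 r₁ × X`;
`G₀ 0 = D`; `G₀ c` vacuum for `‖c‖ < r₁`; `G₀ c = D` off the compact set `c.symm '' B̄`; and on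
the chart source the sections of `G₀ c`, `‖c‖ < r₁`, are the pullbacks `c^* G_c`, `c^* K_c`
(positivity of `G_c` for small `c`: `eventually_forall_posDef`; patching: `InitialDataSet.patch`;
vacuum: the bridge `OpensChart.hamiltonianConstraintFn_eq_hamAt` on `𝓣` and locality off `B̄`).
This is the bookkeeping half of Chruściel–Delay 2003, Cor. 5.11 ("the new solution … can be
smoothly continued to `M ∖ Ω` by `(K₀, g₀)`"). [cite: ChruscielDelay2003, Cor. 5.11] -/
theorem exists_localFamily_of_coordFamily (x₀ : X) (D : InitialDataSet (𝓡 3) X)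
    (hvac : ∀ [D.metric.HasLeviCivita], D.IsVacuumConstraintSolution)
    {ρ : ℝ} (hρT : closedBall (chartAt E3 x₀ x₀) ρ ⊆ (chartAt E3 x₀).target)
    {k : ℕ} {r : ℝ} (hr : 0 < r)
    (Gf Kf : EuclideanSpace ℝ (Fin k) → E3 → E3 →L[ℝ] E3 →L[ℝ] ℝ)
    (hGs : ContDiffOn ℝ ∞ (fun q : EuclideanSpace ℝ (Fin k) × E3 ↦ Gf q.1 q.2)
      (ball 0 r ×ˢ (chartAt E3 x₀).target))
    (hKs : ContDiffOn ℝ ∞ (fun q : EuclideanSpace ℝ (Fin k) × E3 ↦ Kf q.1 q.2)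
      (ball 0 r ×ˢ (chartAt E3 x₀).target))
    (h0 : ∀ z ∈ (chartAt E3 x₀).target,
      Gf 0 z = (D.comap _ (ChartInverse.contMDiff_symm x₀)
        (ChartInverse.injective_mfderiv_symm x₀)).coordHOn z ∧
      Kf 0 z = (D.comap _ (ChartInverse.contMDiff_symm x₀)
        (ChartInverse.injective_mfderiv_symm x₀)).coordKOn z)
    (hoff : ∀ c ∈ ball (0 : EuclideanSpace ℝ (Fin k)) r, ∀ z ∈ (chartAt E3 x₀).target,
      z ∉ closedBall (chartAt E3 x₀ x₀) ρ →
      Gf c z = (D.comap _ (ChartInverse.contMDiff_symm x₀)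
        (ChartInverse.injective_mfderiv_symm x₀)).coordHOn z ∧
      Kf c z = (D.comap _ (ChartInverse.contMDiff_symm x₀)
        (ChartInverse.injective_mfderiv_symm x₀)).coordKOn z)
    (hsym : ∀ c ∈ ball (0 : EuclideanSpace ℝ (Fin k)) r, ∀ z ∈ (chartAt E3 x₀).target, ∀ v w : E3,
      Gf c z v w = Gf c z w v ∧ Kf c z v w = Kf c z w v)
    {ι : Type*} [Fintype ι] (b₀ : Basis ι ℝ E3)
    (hcv : ∀ c ∈ ball (0 : EuclideanSpace ℝ (Fin k)) r, ∀ z ∈ (chartAt E3 x₀).target,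
      MetricCoord.hamAt (Gf c) (Kf c) z = 0 ∧ ∀ Z : E3, MetricCoord.momFn b₀ (Gf c) (Kf c) z Z = 0) :
    ∃ (r₁ : ℝ) (G₀ : EuclideanSpace ℝ (Fin k) → InitialDataSet (𝓡 3) X), 0 < r₁ ∧ r₁ ≤ r ∧
      ContMDiffOn (𝓘(ℝ, EuclideanSpace ℝ (Fin k)).prod (𝓡 3))
        ((𝓡 3).prod 𝓘(ℝ, E3 →L[ℝ] E3 →L[ℝ] ℝ)) ∞
        (fun p : EuclideanSpace ℝ (Fin k) × X ↦
          TotalSpace.mk' (F := E3 →L[ℝ] E3 →L[ℝ] ℝ)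
            (E := fun x : X ↦ TangentSpace (𝓡 3) x →L[ℝ] TangentSpace (𝓡 3) x →L[ℝ] ℝ)
            p.2 ((G₀ p.1).h.inner p.2))
        (ball (0 : EuclideanSpace ℝ (Fin k)) r₁ ×ˢ (univ : Set X)) ∧
      ContMDiffOn (𝓘(ℝ, EuclideanSpace ℝ (Fin k)).prod (𝓡 3))
        ((𝓡 3).prod 𝓘(ℝ, E3 →L[ℝ] E3 →L[ℝ] ℝ)) ∞
        (fun p : EuclideanSpace ℝ (Fin k) × X ↦
          TotalSpace.mk' (F := E3 →L[ℝ] E3 →L[ℝ] ℝ)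
            (E := fun x : X ↦ TangentSpace (𝓡 3) x →L[ℝ] TangentSpace (𝓡 3) x →L[ℝ] ℝ)
            p.2 ((G₀ p.1).k p.2))
        (ball (0 : EuclideanSpace ℝ (Fin k)) r₁ ×ˢ (univ : Set X)) ∧
      G₀ 0 = D ∧
      (∀ c : EuclideanSpace ℝ (Fin k), ‖c‖ < r₁ →
        ∀ [(G₀ c).metric.HasLeviCivita], (G₀ c).IsVacuumConstraintSolution) ∧
      (∀ (c : EuclideanSpace ℝ (Fin k)) (x : X),
        x ∉ (chartAt E3 x₀).symm '' closedBall (chartAt E3 x₀ x₀) ρ →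
        (G₀ c).h.inner x = D.h.inner x ∧ (G₀ c).k x = D.k x) ∧
      (∀ c : EuclideanSpace ℝ (Fin k), ‖c‖ < r₁ → ∀ p ∈ (chartAt E3 x₀).source,
        (G₀ c).h.inner p = pullbackBilin (I := 𝓘(ℝ, E3)) (I' := 𝓡 3) (chartAt E3 x₀) (Gf c) p ∧
        (G₀ c).k p = pullbackBilin (I := 𝓘(ℝ, E3)) (I' := 𝓡 3) (chartAt E3 x₀) (Kf c) p) := by
  set C : Set X := (chartAt E3 x₀).symm '' closedBall (chartAt E3 x₀ x₀) ρ with hCdef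
  have hCc : IsCompact C :=
    (isCompact_closedBall _ _).image_of_continuousOn ((chartAt E3 x₀).continuousOn_symm.mono hρT)
  have hCcl : IsClosed C := hCc.isClosed
  have hCW : C ⊆ (chartAt E3 x₀).source := by
    rintro _ ⟨z, hz, rfl⟩
    exact (chartAt E3 x₀).map_target (hρT hz)
  have hW : IsOpen (chartAt E3 x₀).source := (chartAt E3 x₀).open_source
  -- Step 1: `G_c` is positive definite on the target for small `c`
  have hposev : ∀ᶠ c in 𝓝 (0 : EuclideanSpace ℝ (Fin k)), ∀ z ∈ closedBall (chartAt E3 x₀ x₀) ρ,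
      ∀ v : E3, v ≠ 0 → 0 < Gf c z v v := by
    refine Literature.Analysis.InnerProduct.eventually_forall_posDef (isCompact_closedBall _ _)
      (ball_mem_nhds (0 : EuclideanSpace ℝ (Fin k)) hr) (g := Gf) ?_ ?_
    · exact hGs.continuousOn.mono (prod_mono Subset.rfl hρT)
    · intro z hz v hv
      rw [(h0 z (hρT hz)).1]
      exact coordHOn_pos (D.comap _ (ChartInverse.contMDiff_symm x₀) (ChartInverse.injective_mfderiv_symm x₀)) (hρT hz) v hv
  obtain ⟨r₁', hr₁', hball⟩ := Metric.eventually_nhds_iff_ball.1 hposev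
  set r₁ := min r₁' r with hr₁def
  have hr₁ : 0 < r₁ := lt_min hr₁' hr
  have hr₁r : r₁ ≤ r := min_le_right _ _
  have hcr : ∀ {c : EuclideanSpace ℝ (Fin k)}, ‖c‖ < r₁ → c ∈ ball (0 : EuclideanSpace ℝ (Fin k)) r :=
    fun hc ↦ mem_ball_zero_iff.2 (hc.trans_le hr₁r)
  have hpos : ∀ c : EuclideanSpace ℝ (Fin k), ‖c‖ < r₁ → ∀ z ∈ (chartAt E3 x₀).target,
      ∀ v : E3, v ≠ 0 → 0 < Gf c z v v := by
    intro c hc z hz v hv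
    by_cases hzB : z ∈ closedBall (chartAt E3 x₀ x₀) ρ
    · exact hball c (mem_ball_zero_iff.2 (hc.trans_le (min_le_left _ _))) z hzB v hv
    · rw [(hoff c (hcr hc) z hz hzB).1]
      exact coordHOn_pos (D.comap _ (ChartInverse.contMDiff_symm x₀) (ChartInverse.injective_mfderiv_symm x₀)) hz v hv
  -- Step 2: smoothness of pulled-back fields on the chart source
  have hsmAt : ∀ (S : EuclideanSpace ℝ (Fin k) → E3 → E3 →L[ℝ] E3 →L[ℝ] ℝ),
      ContDiffOn ℝ ∞ (fun q : EuclideanSpace ℝ (Fin k) × E3 ↦ S q.1 q.2)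
        (ball 0 r ×ˢ (chartAt E3 x₀).target) →
      ∀ q : EuclideanSpace ℝ (Fin k) × X, ‖q.1‖ < r₁ → q.2 ∈ (chartAt E3 x₀).source →
        ContMDiffAt (𝓘(ℝ, EuclideanSpace ℝ (Fin k)).prod (𝓡 3))
          ((𝓡 3).prod 𝓘(ℝ, E3 →L[ℝ] E3 →L[ℝ] ℝ)) ∞
          (fun q : EuclideanSpace ℝ (Fin k) × X ↦ TotalSpace.mk' (E3 →L[ℝ] E3 →L[ℝ] ℝ)
            (E := fun p : X ↦ TangentSpace (𝓡 3) p →L[ℝ] TangentSpace (𝓡 3) p →L[ℝ] ℝ) q.2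
            (pullbackBilin (I := 𝓘(ℝ, E3)) (I' := 𝓡 3) (chartAt E3 x₀) (S q.1) q.2)) q := by
    intro S hS q hq1 hq2
    have hq : (q.1, chartAt E3 x₀ q.2) ∈ ball (0 : EuclideanSpace ℝ (Fin k)) r ×ˢ (chartAt E3 x₀).target :=
      ⟨hcr hq1, (chartAt E3 x₀).map_source hq2⟩
    have hSat : ContDiffAt ℝ ∞ (fun q : EuclideanSpace ℝ (Fin k) × E3 ↦ S q.1 q.2)
        (q.1, chartAt E3 x₀ q.2) :=
      hS.contDiffAt ((isOpen_ball.prod (chartAt E3 x₀).open_target).mem_nhds hq)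
    exact ChartInverse.contMDiffAt_pullbackBilin_chart_family x₀ hq2 hSat
  have hsm : ∀ (S : EuclideanSpace ℝ (Fin k) → E3 → E3 →L[ℝ] E3 →L[ℝ] ℝ),
      ContDiffOn ℝ ∞ (fun q : EuclideanSpace ℝ (Fin k) × E3 ↦ S q.1 q.2)
        (ball 0 r ×ˢ (chartAt E3 x₀).target) →
      ∀ c : EuclideanSpace ℝ (Fin k), ‖c‖ < r₁ →
        ContMDiffOn (𝓡 3) ((𝓡 3).prod 𝓘(ℝ, E3 →L[ℝ] E3 →L[ℝ] ℝ)) ∞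
          (fun p : X ↦ TotalSpace.mk' (E3 →L[ℝ] E3 →L[ℝ] ℝ)
            (E := fun p : X ↦ TangentSpace (𝓡 3) p →L[ℝ] TangentSpace (𝓡 3) p →L[ℝ] ℝ) p
            (pullbackBilin (I := 𝓘(ℝ, E3)) (I' := 𝓡 3) (chartAt E3 x₀) (S c) p))
          (chartAt E3 x₀).source := by
    intro S hS c hc p hp
    have hι : ContMDiffAt (𝓡 3) (𝓘(ℝ, EuclideanSpace ℝ (Fin k)).prod (𝓡 3)) ∞
        (fun p' : X ↦ ((c, p') : EuclideanSpace ℝ (Fin k) × X)) p :=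
      contMDiffAt_const.prodMk contMDiffAt_id
    exact ((hsmAt S hS (c, p) hc hp).comp p hι).contMDiffWithinAt
  -- Step 3: agreement with `D` near `∂(source)`: off `C` the pulled-back field is `D`'s
  have hptH : ∀ (S₁ S₂ : E3 → E3 →L[ℝ] E3 →L[ℝ] ℝ) (p : X), S₁ (chartAt E3 x₀ p) = S₂ (chartAt E3 x₀ p) →
      pullbackBilin (I := 𝓘(ℝ, E3)) (I' := 𝓡 3) (chartAt E3 x₀) S₁ p =
        pullbackBilin (I := 𝓘(ℝ, E3)) (I' := 𝓡 3) (chartAt E3 x₀) S₂ p := by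
    intro S₁ S₂ p h
    show (ContinuousLinearMap.precomp ℝ _).comp ((S₁ (chartAt E3 x₀ p)).comp _) =
      (ContinuousLinearMap.precomp ℝ _).comp ((S₂ (chartAt E3 x₀ p)).comp _)
    rw [h]
  have hnotB : ∀ p ∈ (chartAt E3 x₀).source, p ∉ C →
      chartAt E3 x₀ p ∉ closedBall (chartAt E3 x₀ x₀) ρ := fun p hp hpC h ↦
    hpC ⟨_, h, (chartAt E3 x₀).left_inv hp⟩
  have hinjT : ∀ {p : X} (hp : p ∈ (chartAt E3 x₀).source) (v : TangentSpace (𝓡 3) p),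
      mfderiv (𝓡 3) 𝓘(ℝ, E3) (chartAt E3 x₀) p v = 0 → v = 0 := fun hp v h0v ↦
    (mdifferentiable_chart (I := 𝓡 3) x₀).mfderiv_injective hp (h0v.trans (map_zero _).symm)
  -- Step 4: the patch data
  classical
  set h₁ : EuclideanSpace ℝ (Fin k) → Π x : X, TangentSpace (𝓡 3) x →L[ℝ] TangentSpace (𝓡 3) x →L[ℝ] ℝ :=
    fun c p ↦ if ‖c‖ < r₁ then
      pullbackBilin (I := 𝓘(ℝ, E3)) (I' := 𝓡 3) (chartAt E3 x₀) (Gf c) p else D.h.inner p with hh₁def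
  set k₁ : EuclideanSpace ℝ (Fin k) → Π x : X, TangentSpace (𝓡 3) x →L[ℝ] TangentSpace (𝓡 3) x →L[ℝ] ℝ :=
    fun c p ↦ if ‖c‖ < r₁ then
      pullbackBilin (I := 𝓘(ℝ, E3)) (I' := 𝓡 3) (chartAt E3 x₀) (Kf c) p else D.k p with hk₁def
  have hh₁ : ∀ {c : EuclideanSpace ℝ (Fin k)}, ‖c‖ < r₁ → ∀ p,
      h₁ c p = pullbackBilin (I := 𝓘(ℝ, E3)) (I' := 𝓡 3) (chartAt E3 x₀) (Gf c) p :=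
    fun hc p ↦ if_pos hc
  have hk₁ : ∀ {c : EuclideanSpace ℝ (Fin k)}, ‖c‖ < r₁ → ∀ p,
      k₁ c p = pullbackBilin (I := 𝓘(ℝ, E3)) (I' := 𝓡 3) (chartAt E3 x₀) (Kf c) p :=
    fun hc p ↦ if_pos hc
  have hh₁' : ∀ {c : EuclideanSpace ℝ (Fin k)}, ¬ ‖c‖ < r₁ → ∀ p, h₁ c p = D.h.inner p :=
    fun hc p ↦ if_neg hc
  have hk₁' : ∀ {c : EuclideanSpace ℝ (Fin k)}, ¬ ‖c‖ < r₁ → ∀ p, k₁ c p = D.k p :=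
    fun hc p ↦ if_neg hc
  have P : ∀ c, D.PatchData (chartAt E3 x₀).source C (h₁ c) (k₁ c) := by
    intro c
    by_cases hc : ‖c‖ < r₁
    · have e₁ : h₁ c = fun p ↦ pullbackBilin (I := 𝓘(ℝ, E3)) (I' := 𝓡 3) (chartAt E3 x₀) (Gf c) p :=
        funext (hh₁ hc)
      have e₂ : k₁ c = fun p ↦ pullbackBilin (I := 𝓘(ℝ, E3)) (I' := 𝓡 3) (chartAt E3 x₀) (Kf c) p :=
        funext (hk₁ hc)
      refine ⟨hW, hCcl, hCW, ?_, ?_, ?_, ?_, ?_, ?_, ?_⟩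
      · rw [e₁]; exact hsm Gf hGs c hc
      · rw [e₂]; exact hsm Kf hKs c hc
      · intro p hp v w
        rw [hh₁ hc, pullbackBilin_apply, pullbackBilin_apply]
        exact (hsym c (hcr hc) _ ((chartAt E3 x₀).map_source hp) _ _).1
      · intro p hp v hv
        rw [hh₁ hc, pullbackBilin_apply]
        exact hpos c hc _ ((chartAt E3 x₀).map_source hp) _ fun h ↦ hv (hinjT hp v h)
      · intro p hp v w
        rw [hk₁ hc, pullbackBilin_apply, pullbackBilin_apply]
        exact (hsym c (hcr hc) _ ((chartAt E3 x₀).map_source hp) _ _).2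
      · intro p hp hpC
        rw [hh₁ hc, hptH (Gf c) (D.comap _ (ChartInverse.contMDiff_symm x₀) (ChartInverse.injective_mfderiv_symm x₀)).coordHOn p
          (hoff c (hcr hc) _ ((chartAt E3 x₀).map_source hp) (hnotB p hp hpC)).1]
        exact ChartInverse.pullbackBilin_chart_coordHOn_comap x₀ D hp
      · intro p hp hpC
        rw [hk₁ hc, hptH (Kf c) (D.comap _ (ChartInverse.contMDiff_symm x₀) (ChartInverse.injective_mfderiv_symm x₀)).coordKOn p
          (hoff c (hcr hc) _ ((chartAt E3 x₀).map_source hp) (hnotB p hp hpC)).2]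
        exact ChartInverse.pullbackBilin_chart_coordKOn_comap x₀ D hp
    · have e₁ : h₁ c = D.h.inner := funext (hh₁' hc)
      have e₂ : k₁ c = D.k := funext (hk₁' hc)
      refine ⟨hW, hCcl, hCW, ?_, ?_, ?_, ?_, ?_, ?_, ?_⟩
      · rw [e₁]; exact D.h.contMDiff.contMDiffOn
      · rw [e₂]; exact D.contMDiff_k.contMDiffOn
      · intro p _ v w; rw [hh₁' hc]; exact D.h.symm p v w
      · intro p _ v hv; rw [hh₁' hc]; exact D.h.pos p v hv
      · intro p _ v w; rw [hk₁' hc]; exact D.k_symm p v w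
      · intro p _ _; exact hh₁' hc p
      · intro p _ _; exact hk₁' hc p
  -- Step 5: joint smoothness of the patch data on `ball 0 r₁ × source`
  have hjoint : ∀ (S : EuclideanSpace ℝ (Fin k) → E3 → E3 →L[ℝ] E3 →L[ℝ] ℝ)
      (s₁ : EuclideanSpace ℝ (Fin k) → Π x : X,
        TangentSpace (𝓡 3) x →L[ℝ] TangentSpace (𝓡 3) x →L[ℝ] ℝ),
      ContDiffOn ℝ ∞ (fun q : EuclideanSpace ℝ (Fin k) × E3 ↦ S q.1 q.2)
        (ball 0 r ×ˢ (chartAt E3 x₀).target) →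
      (∀ {c : EuclideanSpace ℝ (Fin k)}, ‖c‖ < r₁ → ∀ p,
        s₁ c p = pullbackBilin (I := 𝓘(ℝ, E3)) (I' := 𝓡 3) (chartAt E3 x₀) (S c) p) →
      ContMDiffOn (𝓘(ℝ, EuclideanSpace ℝ (Fin k)).prod (𝓡 3))
        ((𝓡 3).prod 𝓘(ℝ, E3 →L[ℝ] E3 →L[ℝ] ℝ)) ∞
        (fun q : EuclideanSpace ℝ (Fin k) × X ↦ TotalSpace.mk' (E3 →L[ℝ] E3 →L[ℝ] ℝ)
          (E := fun x : X ↦ TangentSpace (𝓡 3) x →L[ℝ] TangentSpace (𝓡 3) x →L[ℝ] ℝ) q.2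
          (s₁ q.1 q.2)) (ball 0 r₁ ×ˢ (chartAt E3 x₀).source) := by
    intro S s₁ hS hs₁ q hq
    have hq1 : ‖q.1‖ < r₁ := mem_ball_zero_iff.1 hq.1
    refine ((hsmAt S hS q hq1 hq.2).congr_of_eventuallyEq ?_).contMDiffWithinAt
    have hev : ∀ᶠ q' : EuclideanSpace ℝ (Fin k) × X in 𝓝 q, ‖q'.1‖ < r₁ := by
      have h : ∀ᶠ q' : EuclideanSpace ℝ (Fin k) × X in 𝓝 q, q'.1 ∈ ball (0 : EuclideanSpace ℝ (Fin k)) r₁ :=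
        continuousAt_fst.preimage_mem_nhds (isOpen_ball.mem_nhds hq.1)
      exact h.mono fun q' hq' ↦ mem_ball_zero_iff.1 hq'
    filter_upwards [hev] with q' hq'
    rw [hs₁ hq']
  -- Step 6: the family
  have hjh := hjoint Gf h₁ hGs hh₁
  have hjk := hjoint Kf k₁ hKs hk₁
  have hsmooth := contMDiffOn_patch_family (D := D) (N := ball (0 : EuclideanSpace ℝ (Fin k)) r₁)
    isOpen_ball P hW hCcl hCW hjh hjk
  refine ⟨r₁, fun c ↦ D.patch (P c), hr₁, hr₁r, hsmooth.1, hsmooth.2, ?_, ?_, ?_, ?_⟩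
  · -- `G₀ 0 = D`
    have h0r : ‖(0 : EuclideanSpace ℝ (Fin k))‖ < r₁ := by rw [norm_zero]; exact hr₁
    refine patch_eq_self (P 0) (fun p hp ↦ ?_) (fun p hp ↦ ?_)
    · rw [hh₁ h0r, hptH (Gf 0) (D.comap _ (ChartInverse.contMDiff_symm x₀) (ChartInverse.injective_mfderiv_symm x₀)).coordHOn p (h0 _ ((chartAt E3 x₀).map_source hp)).1]
      exact ChartInverse.pullbackBilin_chart_coordHOn_comap x₀ D hp
    · rw [hk₁ h0r, hptH (Kf 0) (D.comap _ (ChartInverse.contMDiff_symm x₀) (ChartInverse.injective_mfderiv_symm x₀)).coordKOn p (h0 _ ((chartAt E3 x₀).map_source hp)).2]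
      exact ChartInverse.pullbackBilin_chart_coordKOn_comap x₀ D hp
  · -- vacuum for `‖c‖ < r₁`
    intro c hc inst q
    by_cases hq : q ∈ (chartAt E3 x₀).source
    · -- read through the inverse chart: the comapped datum has readings `(G_c, K_c)`
      obtain ⟨u, rfl⟩ : ∃ u : (⟨(chartAt E3 x₀).target, (chartAt E3 x₀).open_target⟩ : Opens E3),
          (chartAt E3 x₀).symm u = q :=
        ⟨⟨chartAt E3 x₀ q, (chartAt E3 x₀).map_source hq⟩, (chartAt E3 x₀).left_inv hq⟩
      exact isVacuumAt_symm_of_coordVacuum x₀ (D.patch (P c)) (Gf c) (Kf c)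
        (fun p hp ↦ by rw [patch_h_inner_of_mem (P c) hp]; exact hh₁ hc p)
        (fun p hp ↦ by rw [patch_k_of_mem (P c) hp]; exact hk₁ hc p) b₀ u (hcv c (hcr hc) u u.2)
    · -- off the chart source the datum is `D` near `q`
      have hqC : q ∉ C := fun h ↦ hq (hCW h)
      have hev := patch_eventuallyEq_of_not_mem (P c) hqC
      haveI := D.metric.hasLeviCivita
      exact (isVacuumAt_congr (hev.mono fun y hy ↦ hy.1) (hev.mono fun y hy ↦ hy.2)).2 (hvac q)
  · -- support
    intro c x hx
    exact ⟨patch_h_inner_of_not_mem_closed (P c) hx, patch_k_of_not_mem_closed (P c) hx⟩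
  · -- sections on the chart source
    intro c hc p hp
    rw [patch_h_inner_of_mem (P c) hp, patch_k_of_mem (P c) hp]
    exact ⟨hh₁ hc p, hk₁ hc p⟩

/-- The axis maps `s ↦ s e_j` of `ℝᵏ` are smooth. [folklore] -/
theorem contDiff_single {k : ℕ} (j : Fin k) :
    ContDiff ℝ ∞ (fun s : ℝ ↦ (EuclideanSpace.single j s : EuclideanSpace ℝ (Fin k))) := by
  have h : (fun s : ℝ ↦ (EuclideanSpace.single j s : EuclideanSpace ℝ (Fin k))) =
      fun s : ℝ ↦ s • (EuclideanSpace.single j (1 : ℝ) : EuclideanSpace ℝ (Fin k)) := by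
    funext s
    ext i
    simp
  rw [h]
  exact contDiff_id.smul contDiff_const

omit [IsManifold (𝓡 3) ∞ X] [T2Space X] in
/-- **Tangents of a reassembled family on the chart source are pulled-back coordinate
tangents**: if the sections of `G₀ c`, `‖c‖ < r₁`, on the chart source are `c^* S_c` for a
family of coordinate fields `S` jointly `C^∞` on `ball 0 r₁ × c.target`, then
`d/ds|₀ σ_{s e_j}(p) = c^*(∂_{c_j}|₀ S)(p)` at every `p ∈ c.source`. [folklore] -/
theorem deriv_section_eq_pullbackBilin (x₀ : X) {k : ℕ} {r₁ : ℝ} (hr₁ : 0 < r₁)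
    (σ : EuclideanSpace ℝ (Fin k) → Π x : X, TangentSpace (𝓡 3) x →L[ℝ] TangentSpace (𝓡 3) x →L[ℝ] ℝ)
    (S : EuclideanSpace ℝ (Fin k) → E3 → E3 →L[ℝ] E3 →L[ℝ] ℝ)
    (hS : ContDiffOn ℝ ∞ (fun q : EuclideanSpace ℝ (Fin k) × E3 ↦ S q.1 q.2)
      (ball 0 r₁ ×ˢ (chartAt E3 x₀).target))
    (hsec : ∀ c : EuclideanSpace ℝ (Fin k), ‖c‖ < r₁ → ∀ p ∈ (chartAt E3 x₀).source,
      σ c p = pullbackBilin (I := 𝓘(ℝ, E3)) (I' := 𝓡 3) (chartAt E3 x₀) (S c) p)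
    (j : Fin k) {γ : E3 → E3 →L[ℝ] E3 →L[ℝ] ℝ}
    (hγ : ∀ z ∈ (chartAt E3 x₀).target,
      deriv (fun s : ℝ ↦ S (EuclideanSpace.single j s) z) 0 = γ z)
    {p : X} (hp : p ∈ (chartAt E3 x₀).source) :
    deriv (fun s : ℝ ↦ (show E3 →L[ℝ] E3 →L[ℝ] ℝ from σ (EuclideanSpace.single j s) p)) 0 =
      pullbackBilin (I := 𝓘(ℝ, E3)) (I' := 𝓡 3) (chartAt E3 x₀) γ p := by
  have hcp : chartAt E3 x₀ p ∈ (chartAt E3 x₀).target := (chartAt E3 x₀).map_source hp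
  set T : E3 →L[ℝ] E3 := (show E3 →L[ℝ] E3 from mfderiv (𝓡 3) 𝓘(ℝ, E3) (chartAt E3 x₀) p)
    with hT
  -- near `s = 0` the curve is `s ↦ Tᵀ S_{s e_j}(c p) T`
  have hev : (fun s : ℝ ↦ (show E3 →L[ℝ] E3 →L[ℝ] ℝ from σ (EuclideanSpace.single j s) p)) =ᶠ[𝓝 0]
      fun s : ℝ ↦ (ContinuousLinearMap.precomp ℝ T).comp
        ((S (EuclideanSpace.single j s) (chartAt E3 x₀ p)).comp T) := by
    have h : ∀ᶠ s : ℝ in 𝓝 0, ‖(EuclideanSpace.single j s : EuclideanSpace ℝ (Fin k))‖ < r₁ := by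
      have h' : ∀ᶠ s : ℝ in 𝓝 0, s ∈ ball (0 : ℝ) r₁ := isOpen_ball.mem_nhds (mem_ball_self hr₁)
      filter_upwards [h'] with s hs
      have hn : ‖(EuclideanSpace.single j s : EuclideanSpace ℝ (Fin k))‖ = ‖s‖ := by simp
      rw [hn]
      exact mem_ball_zero_iff.1 hs
    filter_upwards [h] with s hs
    rw [hsec _ hs p hp]
    rfl
  rw [hev.deriv_eq]
  have hd : DifferentiableAt ℝ (fun s : ℝ ↦ S (EuclideanSpace.single j s) (chartAt E3 x₀ p)) 0 := by
    have h0 : ((EuclideanSpace.single j (0 : ℝ) : EuclideanSpace ℝ (Fin k)), chartAt E3 x₀ p) ∈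
        ball (0 : EuclideanSpace ℝ (Fin k)) r₁ ×ˢ (chartAt E3 x₀).target := by
      refine ⟨?_, hcp⟩
      have : (EuclideanSpace.single j (0 : ℝ) : EuclideanSpace ℝ (Fin k)) = 0 := by ext i; simp
      rw [this]
      exact mem_ball_self hr₁
    have hSat : ContDiffAt ℝ ∞ (fun q : EuclideanSpace ℝ (Fin k) × E3 ↦ S q.1 q.2)
        ((EuclideanSpace.single j (0 : ℝ) : EuclideanSpace ℝ (Fin k)), chartAt E3 x₀ p) :=
      hS.contDiffAt ((isOpen_ball.prod (chartAt E3 x₀).open_target).mem_nhds h0)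
    have hcomp := hSat.comp (0 : ℝ) (((contDiff_single j).prodMk contDiff_const).contDiffAt)
    exact hcomp.differentiableAt (by simp)
  rw [deriv_precomp_comp_comp T hd, hγ _ hcp]
  rfl

omit [IsManifold (𝓡 3) ∞ X] [T2Space X] in
/-- Where the sections of a family do not depend on the parameter, the tangent vanishes.
[folklore] -/
theorem deriv_section_eq_zero {k : ℕ}
    (σ : EuclideanSpace ℝ (Fin k) → Π x : X, TangentSpace (𝓡 3) x →L[ℝ] TangentSpace (𝓡 3) x →L[ℝ] ℝ)
    (j : Fin k) {p : X} (h : ∀ c, σ c p = σ 0 p) :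
    deriv (fun s : ℝ ↦ (show E3 →L[ℝ] E3 →L[ℝ] ℝ from σ (EuclideanSpace.single j s) p)) 0 = 0 := by
  have heq : (fun s : ℝ ↦ (show E3 →L[ℝ] E3 →L[ℝ] ℝ from σ (EuclideanSpace.single j s) p)) =
      fun _ ↦ (show E3 →L[ℝ] E3 →L[ℝ] ℝ from σ 0 p) := funext fun s ↦ h _
  rw [heq, deriv_const]

end Reassembly

end InitialDataSet

end Literature.Geometry.Lorentzian

end
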